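import Summits.Ventures.Crystal3D.Theorems.StickyWulffConstantGenericWallFloorStackWalkInv
import Summits.Ventures.Crystal3D.Theorems.StickyWulffConstantGenericWallFloorCapperStep
import Summits.Ventures.Crystal3D.Theorems.StickyWulffConstantGenericWallFloorCapperRiseSharp
import Summits.Ventures.Crystal3D.Theorems.StickyWulffConstantGenericWallFloorTwinNormals
import HarnessLib

/-!
# The STACK WALK pays: every certified walker ends at an unsaturated ball, rising `≥ 3/8` per step

HONEST FRAMING. Part of the venture `Summits/Ventures/Crystal3D` (cell `crystal3d-full`), helper
`--supports` the crux `GenericWallFloor` (stmt-Ventures-19480) of `route-Ventures-StickyWulffConstant`,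
registered line `WallLedgerG`, open stub `stub_twoSlabAdhesion` (general fillings).  Sequel of
`…StackWalkDefs` / `…StackWalkInv`.  Input BY NAME: the E1 row C12-55 (`ExactOnly` of the closed vertex
star of one slot), as in the chain ledger.

* `occupied_nonneg_of_cap` — at an exact cap of `F` with normal `n`, every slot of the twin frame on the
  non-negative side of `n` is occupied (the composition plane and the cappers).
* `walk_dispatch` — a certified walker is `≤ 11`-coordinated, or full in its frame, or an exact cap ORIENTED
  along its direction (`exit_unsaturated_or_twinCap` / `capper_unsaturated_or_twinCap`).
* **`walkStep_spec`** — one step preserves `WalkInv`, moves by a unit vector rising `≥ 3/8`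
  (FULL: the direction; POP: the previous direction, a capper of the closing cap; PUSH: the best capper, by
  `best_capper_bounds` with the normal height `≥ 1/7` from `inner_ge_seventh_of_steep_across` at the bottom
  level and from `menu_normal_eq_or_eq_twin` above it), or STOPS at a ball with `≤ 11` contacts.
* `walkRun_spec` — after `k` steps: invariant, `‖Δ‖ ≤ (8/3)·rise`, and rise `≥ 3k/8` unless stopped.
* **`stackWalk_end`** — with fuel `N > (8/3)(H − height)` (`H` a height bound of `X`) the walk has stopped:
  its end ball is in `X`, has at most eleven contacts, lies above the start, within `(8/3)·rise` of it.

WHAT THIS IS NOT: not the stub (the counting/ledger is `…StackLedger`; `ExactOnly` C12-55 is an input);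
F-C1 not moved.
-/

noncomputable section

namespace Summit.Ventures.Crystal3D.Theorems

open Finset
open scoped InnerProductSpace

variable {X : Finset (EuclideanSpace ℝ (Fin 3))}

/-! ### Local lemmas about twin frames -/

/-- The twin frame flips the `n`-component of every vector. -/
theorem inner_twin_eq_neg (F G : EuclideanSpace ℝ (Fin 3) ≃ₗᵢ[ℝ] EuclideanSpace ℝ (Fin 3))
    {n : EuclideanSpace ℝ (Fin 3)} (hn : ‖n‖ = 1) (hG : ∀ x, G x = F x - (2 * ⟪F x, n⟫_ℝ) • n)
    (x : EuclideanSpace ℝ (Fin 3)) : ⟪G x, n⟫_ℝ = -⟪F x, n⟫_ℝ := by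
  have nn : ⟪n, n⟫_ℝ = 1 := by rw [real_inner_self_eq_norm_sq, hn, one_pow]
  rw [hG, inner_sub_left, inner_smul_left, nn]; simp; ring

/-- The twin relation is symmetric. -/
theorem twin_symm (F G : EuclideanSpace ℝ (Fin 3) ≃ₗᵢ[ℝ] EuclideanSpace ℝ (Fin 3))
    {n : EuclideanSpace ℝ (Fin 3)} (hn : ‖n‖ = 1) (hG : ∀ x, G x = F x - (2 * ⟪F x, n⟫_ℝ) • n)
    (x : EuclideanSpace ℝ (Fin 3)) : F x = G x - (2 * ⟪G x, n⟫_ℝ) • n := by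
  rw [inner_twin_eq_neg F G hn hG x, hG x]
  module

/-- **At an exact cap, the non-negative side of the twin frame is occupied.**  If the slots `y + F w` with
`⟪F w, n⟫ ≤ 0` are occupied and the mirror images `y − F w + 2⟪F w, n⟫ n` of the positive slots are
occupied, then for any frame `G x = F x − 2⟪F x, n⟫ n` every `y + G w` with `⟪G w, n⟫ ≥ 0` is occupied. -/
theorem occupied_nonneg_of_cap (F G : EuclideanSpace ℝ (Fin 3) ≃ₗᵢ[ℝ] EuclideanSpace ℝ (Fin 3))
    {n y : EuclideanSpace ℝ (Fin 3)} (hn : ‖n‖ = 1)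
    (hle : ∀ w ∈ fccSlots, ⟪F w, n⟫_ℝ ≤ 0 → y + F w ∈ X)
    (hgt : ∀ w ∈ fccSlots, 0 < ⟪F w, n⟫_ℝ → y + F w ∉ X ∧ y - F w + (2 * ⟪F w, n⟫_ℝ) • n ∈ X)
    (hG : ∀ x, G x = F x - (2 * ⟪F x, n⟫_ℝ) • n) :
    ∀ w ∈ fccSlots, 0 ≤ ⟪G w, n⟫_ℝ → y + G w ∈ X := by
  intro w hw hnn
  have hflip := inner_twin_eq_neg F G hn hG w
  rcases hnn.lt_or_eq with hpos | hzero
  · -- `⟪F w, n⟫ < 0`: `y + G w` is the mirror image of the positive slot `−w`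
    have hneg : ⟪F w, n⟫_ℝ < 0 := by linarith
    have hw' := neg_mem_fccSlots hw
    have hpos' : 0 < ⟪F (-w), n⟫_ℝ := by rw [map_neg, inner_neg_left]; linarith
    have hmem := (hgt (-w) hw' hpos').2
    have e : y - F (-w) + (2 * ⟪F (-w), n⟫_ℝ) • n = y + G w := by
      rw [hG w, map_neg, inner_neg_left]; module
    rwa [e] at hmem
  · -- in-plane: `G w = F w`
    have h0 : ⟪F w, n⟫_ℝ = 0 := by linarith
    have e : G w = F w := by rw [hG w, h0]; simp
    rw [e]; exact hle w hw h0.le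

/-! ### The dispatch at a certified walker -/

/-- **Dispatch.**  A certified walker (`WalkCertified X y e`) in a `1`-separated `X`, with the C12-55 row
exact-only, has at most eleven contacts, or a full `F`-shell, or is an exact cap of `F` oriented along its
direction. -/
theorem walk_dispatch (hX : ∀ p ∈ X, ∀ q ∈ X, p ≠ q → 1 ≤ dist p q)
    {s₀ : EuclideanSpace ℝ (Fin 3)} (hs₀ : s₀ ∈ fccSlots)
    (hcert : ExactOnly 0 (fccSlots.filter fun w => 0 < ⟪w, s₀⟫_ℝ))
    {y : EuclideanSpace ℝ (Fin 3)} {e : WalkEntry} (hdir : e.dir ∈ fccSlots) (hC : WalkCertified X y e) :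
    (X.filter fun q => dist y q = 1).card ≤ 11 ∨ (∀ w ∈ fccSlots, y + e.frame w ∈ X) ∨
      ∃ n, IsOrientedCap X e.frame y e.dir n := by
  classical
  by_cases hfull : ∀ w ∈ fccSlots, y + e.frame w ∈ X
  · exact Or.inr (Or.inl hfull)
  have hv : ∃ v ∈ fccSlots, y + e.frame v ∉ X := by
    by_contra h; push Not at h; exact hfull h
  rcases hC with ⟨hd, hsh⟩ | ⟨n₀, hn₀, hmenu₀, hpos₀, hd, hocc₀⟩
  · rcases exit_unsaturated_or_twinCap hX hs₀ hcert e.frame hdir hd hsh hv with h11 | ⟨n, hn, hmenu, hvn, hle, hgt⟩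
    · exact Or.inl h11
    · exact Or.inr (Or.inr ⟨n, hn, hmenu, hvn, hle, hgt⟩)
  · have key := capper_unsaturated_or_twinCap hX hs₀ hcert e.frame hn₀ hmenu₀ hd hocc₀ hdir hpos₀
    rw [sub_add_cancel] at key
    rcases key with h11 | hall | ⟨n, hn, hmenu, hvn, hle, hgt⟩
    · exact Or.inl h11
    · exact absurd hall hfull
    · exact Or.inr (Or.inr ⟨n, hn, hmenu, hvn, hle, hgt⟩)

/-! ### One step -/

/-- **One step of the stack walk.**  Under `WalkInv` the walker either stops at a ball with at most eleven
contacts, or moves to a state satisfying `WalkInv` by a unit vector rising by at least `3/8`. -/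
theorem walkStep_spec (hX : ∀ p ∈ X, ∀ q ∈ X, p ≠ q → 1 ≤ dist p q)
    {s₀ : EuclideanSpace ℝ (Fin 3)} (hs₀ : s₀ ∈ fccSlots)
    (hcert : ExactOnly 0 (fccSlots.filter fun w => 0 < ⟪w, s₀⟫_ℝ))
    {z : EuclideanSpace ℝ (Fin 3)} (hz : ‖z‖ = 1)
    {s : EuclideanSpace ℝ (Fin 3) × List WalkEntry} (hInv : WalkInv X z s) :
    (walkStep X z s = none ∧ (X.filter fun q => dist s.1 q = 1).card ≤ 11) ∨
    ∃ s', walkStep X z s = some s' ∧ WalkInv X z s' ∧ ‖s'.1 - s.1‖ = 1 ∧ (3 / 8 : ℝ) ≤ ⟪s'.1 - s.1, z⟫_ℝ := by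
  classical
  obtain ⟨y, stk⟩ := s
  obtain ⟨hyX, hS, e, rest, hstk, hC⟩ := hInv
  simp only at hyX hS hstk hC ⊢
  subst hstk
  obtain ⟨hdir, hrise⟩ := hS.top
  set F := e.frame with hF
  set v := e.dir with hv
  have hrpos : 0 < Real.sqrt (2 / 3) := Real.sqrt_pos.2 (by norm_num)
  have hunit : ∀ (G : EuclideanSpace ℝ (Fin 3) ≃ₗᵢ[ℝ] EuclideanSpace ℝ (Fin 3)) {w : EuclideanSpace ℝ (Fin 3)},
      w ∈ fccSlots → ‖G w‖ = 1 := fun G w hw => by rw [LinearIsometryEquiv.norm_map, norm_eq_one_of_mem_fccSlots hw]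
  by_cases hfull : ∀ w ∈ fccSlots, y + F w ∈ X
  · -- FULL: straight on
    refine Or.inr ⟨(y + F v, e :: rest), walkStep_of_full X z y e rest hfull, ⟨hfull v hdir, hS, e, rest, rfl, ?_⟩,
      ?_, ?_⟩
    · left
      refine ⟨by simp [hF, hv, hyX], fun w hw => ?_⟩
      simp only [hF, hv, add_sub_cancel_right]; exact hfull w hw
    · simp only [add_sub_cancel_left]; exact hunit F hdir
    · simp only [add_sub_cancel_left]; exact hrise
  by_cases hcap : ∃ n, IsOrientedCap X F y v n
  · -- CAP
    obtain ⟨n₁, hn₁def⟩ : ∃ n₁, n₁ = Classical.choose hcap := ⟨_, rfl⟩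
    have hspec := Classical.choose_spec hcap
    rw [← hn₁def] at hspec
    obtain ⟨hn₁, hmenu₁, hvn₁, hle₁, hgt₁⟩ := hspec
    have hstep : walkStep X z (y, e :: rest) = some (capMove z y e rest n₁) := by
      rw [hn₁def]; exact walkStep_of_cap X z y e rest hfull hcap
    -- the height of the cap normal
    have hn1z : (1 / 7 : ℝ) ≤ ⟪n₁, z⟫_ℝ := by
      cases rest with
      | nil =>
        obtain ⟨-, hsteep⟩ := hS
        exact inner_ge_seventh_of_steep_across (F v) n₁ z (hunit F hdir) hn₁ hz hvn₁ hsteep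
      | cons e' rest' =>
        obtain ⟨⟨-, hm1, hmenum, hvm, hmz, -, hm2⟩, -, -⟩ := hS
        rcases menu_normal_eq_or_eq_twin F hm1 hn₁ (hunit F hdir) hmenum hmenu₁ hvm hvn₁ with h | h
        · rw [h]; exact hmz
        · rw [h, inner_sub_left, inner_smul_left]; simpa using hm2
    -- POP or PUSH
    by_cases hpop : ∃ e' rest', rest = e' :: rest' ∧ n₁ = e.nrm
    · obtain ⟨e', rest', hrest, hne⟩ := hpop
      subst hrest
      obtain ⟨hSound, ⟨hlink, hum⟩, hS'⟩ := hS
      set G := e'.frame with hG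
      set u := e'.dir with hu
      obtain ⟨hudir, hurise⟩ := hS'.top
      have hmove : capMove z y e (e' :: rest') n₁ = (y + G u, e' :: rest') := capMove_cons_of_eq z y e e' rest' hne
      rw [hmove] at hstep
      -- the frames: `F = R_m G`, so `G = R_m F` with `m = n₁`
      rw [← hne] at hlink hum
      have hGF : ∀ x, G x = F x - (2 * ⟪F x, n₁⟫_ℝ) • n₁ := twin_symm G F hn₁ hlink
      have hoccG := occupied_nonneg_of_cap F G hn₁ hle₁ hgt₁ hGF
      have hmenuG := menu_reflect F G hn₁ hmenu₁ hGF
      have hupos : 0 < ⟪G u, n₁⟫_ℝ := by rw [hum]; exact hrpos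
      refine Or.inr ⟨(y + G u, e' :: rest'), hstep, ⟨hoccG u hudir hupos.le, hS', e', rest', rfl, ?_⟩, ?_, ?_⟩
      · right
        refine ⟨n₁, hn₁, hmenuG, hupos, by simp [hG, hu, hyX], fun w hw hw0 => ?_⟩
        simp only [hG, hu, add_sub_cancel_right]; exact hoccG w hw hw0
      · simp only [add_sub_cancel_left]; exact hunit G hudir
      · simp only [add_sub_cancel_left]; exact hurise
    · -- PUSH
      have hmove : capMove z y e rest n₁ = pushMove z y e rest n₁ := by
        cases rest with
        | nil => rfl
        | cons e' rest' =>
          have hne : n₁ ≠ e.nrm := fun h => hpop ⟨e', rest', rfl, h⟩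
          exact capMove_cons_of_ne z y e e' rest' hne
      rw [hmove] at hstep
      set F' := twinFrame F n₁ with hF'
      have hF'x : ∀ x, F' x = F x - (2 * ⟪F x, n₁⟫_ℝ) • n₁ := fun x => twinFrame_apply F hn₁ x
      have hflip : ∀ x, ⟪F' x, n₁⟫_ℝ = -⟪F x, n₁⟫_ℝ := inner_twin_eq_neg F F' hn₁ hF'x
      have hmenu' := menu_reflect F F' hn₁ hmenu₁ hF'x
      have hocc' := occupied_nonneg_of_cap F F' hn₁ hle₁ hgt₁ hF'x
      -- the positive slots of `F'` and the best capper
      set S := fccSlots.filter fun q => 0 < ⟪F' q, n₁⟫_ℝ with hSdef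
      have hSne : S.Nonempty := by
        refine ⟨-v, Finset.mem_filter.2 ⟨neg_mem_fccSlots hdir, ?_⟩⟩
        rw [map_neg, inner_neg_left, hflip, hvn₁, neg_neg]; exact hrpos
      obtain ⟨hqS, hqmax⟩ := bestCapper_spec F' n₁ z hSne
      set q := bestCapper F' n₁ z with hq
      obtain ⟨hqdir, hqpos⟩ := Finset.mem_filter.1 hqS
      have hqn : ⟪F' q, n₁⟫_ℝ = Real.sqrt (2 / 3) := by
        rcases hmenu' q hqdir with h | h | h
        · rw [h] at hqpos; exact absurd hqpos (lt_irrefl 0)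
        · exact h
        · rw [h] at hqpos; linarith
      -- the far frame of `n₁` in `F'` and the sharp rise bound
      obtain ⟨q₁, hq₁, q₂, hq₂, q₃, hq₃, hn1, hn2, hn3, h12, h13, h23, -, hexh⟩ := exists_far_frame F' hn₁ hmenu'
      have hle_of : ∀ {q'}, q' ∈ fccSlots → ⟪F' q', n₁⟫_ℝ = Real.sqrt (2 / 3) → ⟪F' q', z⟫_ℝ ≤ ⟪F' q, z⟫_ℝ :=
        fun {q'} hq' hq'n => hqmax q' (Finset.mem_filter.2 ⟨hq', by rw [hq'n]; exact hrpos⟩)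
      have hMeq : ⟪F' q, z⟫_ℝ = ⟪F' q₁, z⟫_ℝ ∨ ⟪F' q, z⟫_ℝ = ⟪F' q₂, z⟫_ℝ ∨ ⟪F' q, z⟫_ℝ = ⟪F' q₃, z⟫_ℝ := by
        rcases hexh q hqdir hqpos with h | h | h
        · left; rw [h]
        · right; left; rw [h]
        · right; right; rw [h]
      have hpair : ∀ {a b : EuclideanSpace ℝ (Fin 3)}, ⟪a, b⟫_ℝ = 1 / 2 → ⟪F' a, F' b⟫_ℝ = 1 / 2 :=
        fun h => by rw [LinearIsometryEquiv.inner_map_map]; exact h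
      obtain ⟨hM, hM2⟩ := best_capper_bounds (hunit F' hq₁) (hunit F' hq₂) (hunit F' hq₃) hn₁ hz
        (hpair h12) (hpair h13) (hpair h23) hn1 hn2 hn3 hn1z (hle_of hq₁ hn1) (hle_of hq₂ hn2) (hle_of hq₃ hn3) hMeq
      have hpush : pushMove z y e rest n₁ = (y + F' q, ⟨F', q, n₁⟩ :: e :: rest) := rfl
      rw [hpush] at hstep
      refine Or.inr ⟨(y + F' q, ⟨F', q, n₁⟩ :: e :: rest), hstep,
        ⟨hocc' q hqdir hqpos.le, ?_, ⟨F', q, n₁⟩, e :: rest, rfl, ?_⟩, ?_, ?_⟩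
      · -- the new stack is sound
        show StackSound z (⟨F', q, n₁⟩ :: e :: rest)
        exact ⟨⟨hqdir, hn₁, hmenu', hqn, hn1z, hM, hM2⟩, ⟨hF'x, hvn₁⟩, hS⟩
      · right
        refine ⟨n₁, hn₁, hmenu', hqpos, by simp [hyX], fun w hw hw0 => ?_⟩
        simp only [add_sub_cancel_right]; exact hocc' w hw hw0
      · simp only [add_sub_cancel_left]; exact hunit F' hqdir
      · simp only [add_sub_cancel_left]; exact hM
  · -- STOP: the ball pays
    refine Or.inl ⟨walkStep_of_stop X z y e rest hfull hcap, ?_⟩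
    rcases walk_dispatch hX hs₀ hcert hdir hC with h11 | hall | hc
    · exact h11
    · exact absurd hall hfull
    · exact absurd hc hcap

/-! ### The run -/

/-- **The run.**  After `k` steps from a state satisfying `WalkInv`: the invariant holds, the displacement is
at most `8/3` of the rise, and unless the walker has stopped the rise is at least `3k/8`. -/
theorem walkRun_spec (hX : ∀ p ∈ X, ∀ q ∈ X, p ≠ q → 1 ≤ dist p q)
    {s₀ : EuclideanSpace ℝ (Fin 3)} (hs₀ : s₀ ∈ fccSlots)
    (hcert : ExactOnly 0 (fccSlots.filter fun w => 0 < ⟪w, s₀⟫_ℝ))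
    {z : EuclideanSpace ℝ (Fin 3)} (hz : ‖z‖ = 1) :
    ∀ (k : ℕ) (s : EuclideanSpace ℝ (Fin 3) × List WalkEntry), WalkInv X z s →
      WalkInv X z (walkRun X z k s) ∧
      ‖(walkRun X z k s).1 - s.1‖ ≤ 8 / 3 * ⟪(walkRun X z k s).1 - s.1, z⟫_ℝ ∧
      (walkStep X z (walkRun X z k s) ≠ none → (3 / 8 : ℝ) * k ≤ ⟪(walkRun X z k s).1 - s.1, z⟫_ℝ)
  | 0, s, hInv => by simp [hInv]
  | k + 1, s, hInv => by
    rcases walkStep_spec hX hs₀ hcert hz hInv with ⟨hnone, -⟩ | ⟨s', hsome, hInv', hnorm, hrise⟩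
    · rw [walkRun_succ_of_none X z k hnone]
      refine ⟨hInv, by simp, fun h => absurd hnone h⟩
    · rw [walkRun_succ_of_some X z k hsome]
      obtain ⟨hI, hdisp, hcount⟩ := walkRun_spec hX hs₀ hcert hz k s' hInv'
      have hsplit : ⟪(walkRun X z k s').1 - s.1, z⟫_ℝ =
          ⟪(walkRun X z k s').1 - s'.1, z⟫_ℝ + ⟪s'.1 - s.1, z⟫_ℝ := by
        rw [← inner_add_left]; congr 1; abel
      have htri : ‖(walkRun X z k s').1 - s.1‖ ≤ ‖(walkRun X z k s').1 - s'.1‖ + ‖s'.1 - s.1‖ :=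
        norm_sub_le_norm_sub_add_norm_sub _ _ _
      refine ⟨hI, ?_, fun h => ?_⟩
      · rw [hnorm] at htri
        rw [hsplit]
        linarith
      · have := hcount h
        rw [hsplit]
        push_cast at this ⊢
        linarith

/-- **The stack walk pays.**  `X` `1`-separated with heights `⟪p, z⟫ ≤ H` (`z` the unit vertical), the C12-55
row exact-only, a state `s` satisfying `WalkInv X z s`, and fuel `N` with `8(H − ⟪s.1, z⟫) < 3N`.  Then the
walk has stopped: its end ball `y` is in `X`, has at most ELEVEN contacts, and
`0 ≤ ⟪y − s.1, z⟫`, `‖y − s.1‖ ≤ (8/3) ⟪y − s.1, z⟫`; moreover the end state still satisfies `WalkInv`. -/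
theorem stackWalk_end (hX : ∀ p ∈ X, ∀ q ∈ X, p ≠ q → 1 ≤ dist p q)
    {s₀ : EuclideanSpace ℝ (Fin 3)} (hs₀ : s₀ ∈ fccSlots)
    (hcert : ExactOnly 0 (fccSlots.filter fun w => 0 < ⟪w, s₀⟫_ℝ))
    {z : EuclideanSpace ℝ (Fin 3)} (hz : ‖z‖ = 1) {H : ℝ} (hH : ∀ p ∈ X, ⟪p, z⟫_ℝ ≤ H)
    {s : EuclideanSpace ℝ (Fin 3) × List WalkEntry} (hInv : WalkInv X z s)
    {N : ℕ} (hN : 8 * (H - ⟪s.1, z⟫_ℝ) < 3 * N) :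
    (walkRun X z N s).1 ∈ X ∧
      ((X.filter fun q => dist (walkRun X z N s).1 q = 1).card ≤ 11) ∧
      0 ≤ ⟪(walkRun X z N s).1 - s.1, z⟫_ℝ ∧
      ‖(walkRun X z N s).1 - s.1‖ ≤ 8 / 3 * ⟪(walkRun X z N s).1 - s.1, z⟫_ℝ ∧
      WalkInv X z (walkRun X z N s) ∧ walkStep X z (walkRun X z N s) = none := by
  obtain ⟨hI, hdisp, hcount⟩ := walkRun_spec hX hs₀ hcert hz N s hInv
  have hyX : (walkRun X z N s).1 ∈ X := hI.1
  -- the walk has stopped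
  have hstop : walkStep X z (walkRun X z N s) = none := by
    by_contra h
    have h1 := hcount h
    have h2 : ⟪(walkRun X z N s).1 - s.1, z⟫_ℝ ≤ H - ⟪s.1, z⟫_ℝ := by
      rw [inner_sub_left]; linarith [hH _ hyX]
    linarith
  have hnonneg : 0 ≤ ⟪(walkRun X z N s).1 - s.1, z⟫_ℝ := by nlinarith [norm_nonneg ((walkRun X z N s).1 - s.1)]
  refine ⟨hyX, ?_, hnonneg, hdisp, hI, hstop⟩
  -- the stopped ball pays
  obtain ⟨-, hS, e, rest, hstk, hC⟩ := hI
  have hstop' : walkStep X z ((walkRun X z N s).1, e :: rest) = none := by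
    have : walkRun X z N s = ((walkRun X z N s).1, (walkRun X z N s).2) := rfl
    rw [this, hstk] at hstop; exact hstop
  obtain ⟨hnf, hnc⟩ := not_full_not_cap_of_walkStep_eq_none X z _ e rest hstop'
  rw [hstk] at hS
  rcases walk_dispatch hX hs₀ hcert hS.top.1 hC with h11 | hall | hc
  · exact h11
  · exact absurd hall hnf
  · exact absurd hc hnc

end Summit.Ventures.Crystal3D.Theorems

end
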